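import Summits.QuantumFields.YangMills.Theorems.BalabanUVNodesN12TowerSiteGraphConnectedNested
import Literature.MathematicalPhysics.QuantumFieldTheory.Balaban1983to89.B15DeterminingSetsB
import HarnessLib

/-!
# BalabanUVNodes ∕ N12 — THE TOWER-SITE CONSTRAINT GRAPH OF PRINT's DATUM `lamBondsSeq Ω k` ([II] (2.3): `Λ_j` as the DIFFERENCE of the bond sets) IS CONNECTED FOR EVERY NESTED
# BLOCK-UNION SEQUENCE WITH ONE-BLOCK COLLARS — the print-datum twin of this seat's g22 `…N12TowerSiteGraphConnectedNested` (lane word dag-n12-c g34 «w6 take §4-AUDIT»)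

[Balaban1984PropagatorsII] = «[II]», (2.3) p. 224 (*«Λ_j = Ω_j^{(j)} ∖ Ω_{j+1}^{(j)}, j = 1, …, k − 1, Λ_k = Ω_k^{(k)}, Λ₀ = Ω₁ᶜ (2.3) for the sets of sites and the sets of bonds»*;
ruling (α) of record: as a set of BONDS `Λ_j` is the difference `st(Ω_j^{(j)}) ∖ st(Ω_{j+1}^{(j)})` — the INWARD connectors are dropped, the OUTWARD connectors kept);
[Balaban1988Convergent] = «[III]», (2.1) p. 254, (2.2) p. 255 (`𝐁 = {Γ_j}`), (2.13) pp. 256–257; [Balaban1985RegularSpaces] = «[6]», (1.3)–(1.6) p. 77 (one-block collars),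
(1.14) p. 78 (the gauge is pinned at BOTH end-points of a constrained bond); [Balaban1987RG1] (0.1)–(0.3) pp. 251–252 (block lattices, centres; bookkeeping);
[Balaban1985Variational] = «[15]», Thm 1 p. 279 («a unique critical orbit»), (3)–(4), (7) p. 278.

Cell `pub-ymgap` (HUMAN RULINGS D-0062 ∕ D-0149), WIDTH SEAT `pub-ymgap-dag-n12-w6` g24 (node N12 = [B15]; key K1⁹ `stmt-QuantumFields-27364`, `--kind proof --supports … --as helper`;
count-neutral).  THEOREMS ONLY (0 `def`, 0 `instance`, 0 `sorry`).  GREEN imports only: this seat's g22 `…N12TowerSiteGraphConnectedNested` (✓, (b)-datum edition) and the definer's F0a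
`Literature/…/B15DeterminingSetsB` (✓, `lamBondsSeq`); nothing of the `Node00/Record13*` cone is imported.  Pure lattice combinatorics BY NAME over the lane's (dag-n12-c g30)
`…N12FlatDatumRigidityNestedPrelim` §1 (levels for `genSet Ω k` under (N) `Ω (j+1) ⊆ Ω j`, (B) `IsBlockUnion j (Ω j)`, (S) the one-block collar: `exists_level_genSet`, `level_unique_genSet`,
`levels_near_of_shift_genSet`, `mem_of_level`, `not_mem_succ_of_level`, `mem_genSet_of_blockOf_eq_outerBlock`), this seat's g17 `…TowerSiteGraphConnectedBjPrelim.blockIter_shift_or`,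
dag-n12-w3's `N12BlockChains.exists_blockWalk` and `N12RootedForest.exists_word_walkEnd_eq`, dag-n21-e's `blockIter_embIter`.

WHY (numbers, not adjectives).  The (E∕U) name at PRINT's datum (dag-n12-c g34 ✓p767125 `B11Thm1ExistsUniqueTokensGB.VariationalThm1EUSepTop7MGB … (lamDatum F) …`) carries [15]
Thm 1's tower-central UNIQUENESS clause, which dag-n12-w1's `N12Thm1CentralLetterTwistObstruction.not_T1central_flat_of_disconnected` refutes at the flat base field from
DISCONNECTION DATA `(T, hT, hz₁, hz₂)` (a set `T` of fine sites closed under the constrained bonds, holding one tower site, missing another).  At the (b)-datum `bondsOf (genSet Ω k ·)`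
this seat's g22 file proved the data cannot be supplied ((N)(B)(S), `1 ≤ k ≤ m + K`); PRINT's datum `lamBondsSeq Ω k j ⊆ bondsOf (genSet Ω k j)` drops every INWARD connector
`(y ∈ Γ_j^{(j)}, y′ ∈ Ω_{j+1}^{(j)})` (`j < k`), so closedness is WEAKER and connectivity is re-proved here — the FIRST GATE before an (E∕U) producer item is filed at `lamDatum`
(lane + dag-n12-d, pub-ymgap INBOX 2026-08-30T09:09:44Z).
THE PROOF (g22's gluing re-run on print's bonds — the inward connectors were never on its path).  `τ x := ι_ℓ B^ℓ(x)` (`ℓ` = level of `x`); `τ x ∈ T` is invariant along every fine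
bond (§2): at EQUAL levels the bond `⟨B^ℓ(x), μ⟩` has BOTH ends in `Γ_ℓ^{(ℓ)}`, so both `(ℓ+1)`-blocks are off `Ω_{ℓ+1}` ((B), `blockOf_not_mem_pts_succ`) — a print bond; at levels
`ℓ`, `ℓ+1` the `(ℓ+1)`-block `w ⊄ Ω_{ℓ+1}` of the shallower site is `μ`-adjacent to the `Γ_{ℓ+1}`-block of the deeper one: `⟨w, μ⟩` is the level-`(ℓ+1)` OUTWARD CONNECTOR, KEPT by
print (`w ⊄ Ω_{ℓ+1} ⊇ Ω_{ℓ+2}` by (N); a `Γ_{ℓ+1}`-block is off `Ω_{ℓ+2}` by (B); nothing excluded at `ℓ + 1 = k`), and the `ℓ`-sites of `w` (all in `Γ_ℓ`, (B)(S)) are joined INSIDE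
`w` by intra-block level-`ℓ` bonds (both end blocks `= w` — print bonds; §1, w3's `exists_blockWalk`).  The fine torus is connected ⇒ `τ x ∈ T` is constant ⇒ §3.

CONTENTS (namespace `Summit.QuantumFields.YangMills.BalabanUVNodes.N12TowerSiteGraphConnectedNestedLam`; generic `P : Params`): §0 `blockOf_not_mem_pts_succ`, `mem_lamBondsSeq_of_not_deep`,
`src_or_tgt_mem_genSet_of_mem_lamBondsSeq`; §1 ★ `embIter_mem_iff_of_outerBlock_lam`; §2 ★★ `towerProj_mem_iff_shift_same_lam` ∕ `_up_lam` ∕ `_down_lam` ∕ `towerProj_mem_iff_shift_lam`,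
`levelPred_iff_shift_lam` ∕ `levelPred_walkEnd_lam` ∕ `levelPred_const_lam`; §3 `levelPred_embIter_iff`, ★★★ `towerSite_mem_of_closed_lamBondsSeq_of_mem_genSet` (site-fed: a `T` closed
under print's bonds that holds the representative of one `Γ`-site holds both ends of every print bond), ★★★ `towerSite_mem_of_closed_lamBondsSeq`, ★★★
`towerSites_subset_of_closed_lamBondsSeq`, ★★ `not_disconnected_towerSiteGraph_lamBondsSeq`.

HONEST FRAMING.  A located PRECONDITION (graph connectivity at print's datum) of the uniqueness clause, for every (N)(B)(S) sequence — NOT [15] Thm 1, NOT a producer of the (E∕U)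
name, NOTHING about record instances beyond (N)(B)(S); nothing of Bałaban's estimates asserted or refuted; count-neutral helper; N12 NOT discharged; K0⁷∕K1⁹ NOT closed; counts of
record unmoved; one finite 𝕋⁴ programme at fixed ε — R4 closes the conditional rung `BalabanLadder.UV` only; the Yang–Mills mass gap (Clay) is NOT proved; nothing continuum ∕ ℝ⁴ ∕ OS.
-/

namespace Summit.QuantumFields.YangMills.BalabanUVNodes.N12TowerSiteGraphConnectedNestedLam

open Set Literature.MathematicalPhysics.QuantumFieldTheory.Balaban1983to89
open B15DeterminingSets (DetSet pts mem_pts bondsOf embIter genSet)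
open B15DeterminingSetsB (lamBondsSeq mem_lamBondsSeq_iff lamBondsSeq_subset_bondsOf_genSet)
open B14.Eq22Determines (blockIter blockIter_zero blockIter_succ IsBlockUnion)
open T4Continuum (walkEnd)
open Summit.QuantumFields.YangMills.BalabanUVNodes.N12RootedForest (exists_word_walkEnd_eq)
open Summit.QuantumFields.YangMills.BalabanUVNodes.N12BlockChains (exists_blockWalk)
open Summit.QuantumFields.YangMills.Theorems.N21ReadSetSupport (blockIter_embIter)
open Summit.QuantumFields.YangMills.BalabanUVNodes.N12TowerSiteGraphConnectedBjPrelim (blockIter_shift_or)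
open Summit.QuantumFields.YangMills.BalabanUVNodes.N12FlatDatumRigidityNestedPrelim (exists_level_genSet level_unique_genSet levels_near_of_shift_genSet mem_of_level
  not_mem_succ_of_level mem_genSet_of_blockOf_eq_outerBlock subset_of_le)

variable {P : Params} {k : ℕ} {Ω : ℕ → Set (Site P 0)}

/-! ## §0  Print's exclusion clause under (B): blocks off `Ω_{j+1}` are not deep -/

/-- **NOT DEEP**: under (B) at scale `j + 1 ≤ k`, a `j`-site `s` whose `(j+1)`-block is the `(j+1)`-block of a fine site `x ∉ Ω_{j+1}` has `blockOf s ∉ Ω_{j+1}^{(j+1)}` — the block's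
representative lies in `Ω_{j+1}` iff `x` does. [cite: Balaban1984PropagatorsII, (2.3) p.224; Balaban1988Convergent, (2.1) p.254 (unions of blocks)] -/
theorem blockOf_not_mem_pts_succ (hBU : ∀ j, 1 ≤ j → j ≤ k → IsBlockUnion j (Ω j)) {j : ℕ} (hj : j + 1 ≤ k)
    {x : Site P 0} (hx : x ∉ Ω (j + 1)) {s : Site P j} (hs : blockOf s = blockIter (j + 1) x) :
    blockOf s ∉ pts (j + 1) (Ω (j + 1)) := by
  intro h
  have h1 : embIter (j + 1) (blockIter (j + 1) x) ∈ Ω (j + 1) := by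
    rw [← hs]; exact mem_pts.1 h
  exact hx ((hBU (j + 1) (by omega) hj x).2 h1)

/-- A bond meeting `Γ_j^{(j)}` neither of whose end blocks is deep (for `j < k`) is a bond of print's `Λ_j` (repackaged `lamBondsSeq`). [cite: Balaban1984PropagatorsII, (2.3) p.224] -/
theorem mem_lamBondsSeq_of_not_deep {j : ℕ} {c : PBond P j} (hc : c ∈ bondsOf (genSet Ω k j))
    (hs : j < k → blockOf c.src ∉ pts (j + 1) (Ω (j + 1))) (ht : j < k → blockOf c.tgt ∉ pts (j + 1) (Ω (j + 1))) :
    c ∈ lamBondsSeq Ω k j :=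
  (mem_lamBondsSeq_iff Ω k c).2 ⟨hc, fun h => ⟨hs h, ht h⟩⟩

/-- A bond of print's `Λ_j` meets `Γ_j^{(j)}`: one of its end-points is a `Γ_j`-site. [cite: Balaban1984PropagatorsII, (2.3) p.224; Balaban1988Convergent, (2.2) p.255] -/
theorem src_or_tgt_mem_genSet_of_mem_lamBondsSeq {j : ℕ} {c : PBond P j} (hc : c ∈ lamBondsSeq Ω k j) :
    c.src ∈ genSet Ω k j ∨ c.tgt ∈ genSet Ω k j :=
  lamBondsSeq_subset_bondsOf_genSet Ω k j hc

/-! ## §1  The `ℓ`-sites of the outer `(ℓ+1)`-block are `T`-equivalent (intra-block bonds are print bonds) -/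

/-- ★ **THE `ℓ`-SITES OF THE OUTER `(ℓ+1)`-BLOCK ARE `T`-EQUIVALENT** for every `T` closed under PRINT's bonds `lamBondsSeq Ω k`: two `ℓ`-sites `v, v'` of the block `w = B^{ℓ+1}(x)` of
`x ∉ Ω_{ℓ+1}` adjacent to `Ω_{ℓ+1}` (`ℓ + 1 ≤ k`) have `ι_ℓ v ∈ T ↔ ι_ℓ v' ∈ T` — dag-n12-w3's lattice path INSIDE `w` (`exists_blockWalk`) runs through bonds with BOTH end-points in `w`:
`Γ_ℓ`-sites by the lane's `mem_genSet_of_blockOf_eq_outerBlock` ((B)(S)), and not deep since `w` is off `Ω_{ℓ+1}` (`blockOf_not_mem_pts_succ`), so each bond of the path is a print bond.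
[cite: Balaban1984PropagatorsII, (2.3) p.224; Balaban1988Convergent, (2.2) p.255; Balaban1987RG1, (0.3) p.252 (bookkeeping)] -/
theorem embIter_mem_iff_of_outerBlock_lam (hk1 : 1 ≤ k) (hk : k ≤ P.m + P.K) (hBU : ∀ j, 1 ≤ j → j ≤ k → IsBlockUnion j (Ω j))
    (hsep : ∀ j, 1 ≤ j → j + 1 ≤ k → ∀ (x z : Site P 0) (μ : Fin P.d), (z = x.shift μ ∨ x = z.shift μ) → z ∈ Ω (j + 1) →
      ∀ y : Site P 0, blockIter (j + 1) y = blockIter (j + 1) x → y ∈ Ω j)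
    {ℓ : ℕ} (hℓk : ℓ + 1 ≤ k) {x z : Site P 0} {μ : Fin P.d} (hadj : z = x.shift μ ∨ x = z.shift μ)
    (hz : z ∈ Ω (ℓ + 1)) (hx : x ∉ Ω (ℓ + 1)) {T : Set (Site P 0)}
    (hT : ∀ j, j ≤ k → ∀ c ∈ lamBondsSeq Ω k j, (embIter j c.src ∈ T ↔ embIter j c.tgt ∈ T))
    (v v' : Site P ℓ) (hv : blockOf v = blockIter (ℓ + 1) x) (hv' : blockOf v' = blockIter (ℓ + 1) x) :
    (embIter ℓ v ∈ T ↔ embIter ℓ v' ∈ T) := by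
  -- a level-`ℓ` bond with BOTH end-points in the block is a print bond
  have hbond : ∀ c : PBond P ℓ, blockOf c.src = blockIter (ℓ + 1) x → blockOf c.tgt = blockIter (ℓ + 1) x →
      (embIter ℓ c.src ∈ T ↔ embIter ℓ c.tgt ∈ T) := fun c hcs hct =>
    hT ℓ (by omega) c (mem_lamBondsSeq_of_not_deep (Or.inl (mem_genSet_of_blockOf_eq_outerBlock hk1 hk hBU hsep hℓk hadj hz hx hcs))
      (fun _ => blockOf_not_mem_pts_succ hBU hℓk hx hcs) (fun _ => blockOf_not_mem_pts_succ hBU hℓk hx hct))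
  -- dag-n12-w3's walk inside the block from `v` to `v'`
  obtain ⟨ch, -, hmem, hend, hcons⟩ := exists_blockWalk (show ℓ + 1 ≤ P.m + P.K by omega) _ v v' (hv.trans hv'.symm) rfl
  -- `T`-membership passes along any such walk (induction on the walk, generalising its start)
  have key : ∀ (ch : List (PBond P ℓ × Bool)) (q : Site P ℓ),
      (∀ l ∈ ch, blockOf l.1.src = blockIter (ℓ + 1) x ∧ blockOf l.1.tgt = blockIter (ℓ + 1) x) →
      (∀ (pre post : List (PBond P ℓ × Bool)) (l : PBond P ℓ × Bool), ch = pre ++ l :: post →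
        (l.2 = true → walkEnd q (pre.map fun l => (l.1.dir, l.2)) = l.1.src) ∧
        (l.2 = false → walkEnd q (pre.map fun l => (l.1.dir, l.2)) = l.1.tgt)) →
      (embIter ℓ q ∈ T ↔ embIter ℓ (walkEnd q (ch.map fun l => (l.1.dir, l.2))) ∈ T) := by
    intro ch
    induction ch with
    | nil => intro q _ _; exact Iff.rfl
    | cons l₀ ch ih =>
      intro q hblk hread
      obtain ⟨b, s⟩ := l₀
      have h0 := hread [] ch (b, s) rfl
      have hb : embIter ℓ b.src ∈ T ↔ embIter ℓ b.tgt ∈ T :=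
        hbond b (hblk (b, s) List.mem_cons_self).1 (hblk (b, s) List.mem_cons_self).2
      -- the tail, read from the site after the first step
      have htail : ∀ q₁ : Site P ℓ, (∀ rest, walkEnd q ((b.dir, s) :: rest) = walkEnd q₁ rest) →
          (embIter ℓ q₁ ∈ T ↔ embIter ℓ (walkEnd q (((b, s) :: ch).map fun l => (l.1.dir, l.2))) ∈ T) := by
        intro q₁ hq₁
        rw [List.map_cons, hq₁]
        refine ih q₁ (fun l hl => hblk l (List.mem_cons_of_mem _ hl)) (fun pre post l hch => ?_)
        have h := hread ((b, s) :: pre) post l (by rw [hch]; rfl)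
        rw [List.map_cons, hq₁] at h
        exact h
      cases s
      · -- backward step: `q = b₊`, next site `b₋`
        have hq : q = b.tgt := h0.2 rfl
        have hnext : ∀ rest, walkEnd q ((b.dir, false) :: rest) = walkEnd b.src rest := fun rest => by
          rw [hq]; show walkEnd ((b.src.shift b.dir).unshift b.dir) rest = _; rw [B10StarCount.unshift_shift]
        rw [← htail b.src hnext, hq]
        exact hb.symm
      · -- forward step: `q = b₋`, next site `b₊`
        have hq : q = b.src := h0.1 rfl
        have hnext : ∀ rest, walkEnd q ((b.dir, true) :: rest) = walkEnd b.tgt rest := fun rest => by rw [hq]; rfl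
        rw [← htail b.tgt hnext, hq]
        exact hb
  have h := key ch v (fun l hl => ⟨(hmem l hl).1.trans hv', (hmem l hl).2.trans hv'⟩) hcons
  rw [hend] at h
  exact h

/-! ## §2  The tower projection `τ x = ι_ℓ B^ℓ(x)` is `T`-invariant along every fine bond, hence constant on the torus -/

/-- ★★ **SAME LEVEL**: if the `j`-blocks of `x` and of `x + e_μ` are BOTH `Γ_j`-sites (`j ≤ k`), then `ι_j B^j(x) ∈ T ↔ ι_j B^j(x + e_μ) ∈ T` — the two blocks are equal, or
`μ`-adjacent along the bond `⟨B^j(x), μ⟩` with both ends in `Γ_j^{(j)}`, hence (for `j < k`) both end blocks off `Ω_{j+1}` (the levels forbid `Ω_{j+1}`; (B)): a print bond.  (With only ONE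
end in `Γ_j` the bond could be an inward connector — hence both level hypotheses.) [cite: Balaban1984PropagatorsII, (2.3) p.224; Balaban1988Convergent, (2.2) p.255; Balaban1987RG1, (0.3) p.252 (bookkeeping)] -/
theorem towerProj_mem_iff_shift_same_lam (hk : k ≤ P.m + P.K) (hBU : ∀ j, 1 ≤ j → j ≤ k → IsBlockUnion j (Ω j)) {T : Set (Site P 0)}
    (hT : ∀ j, j ≤ k → ∀ c ∈ lamBondsSeq Ω k j, (embIter j c.src ∈ T ↔ embIter j c.tgt ∈ T))
    {x : Site P 0} {μ : Fin P.d} {j : ℕ} (hj : j ≤ k) (h : blockIter j x ∈ genSet Ω k j) (h' : blockIter j (x.shift μ) ∈ genSet Ω k j) :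
    (embIter j (blockIter j x) ∈ T ↔ embIter j (blockIter j (x.shift μ)) ∈ T) := by
  rcases blockIter_shift_or (hj.trans hk) x μ with e | e
  · rw [e]
  · rw [e]
    refine hT j hj ⟨blockIter j x, μ⟩ (mem_lamBondsSeq_of_not_deep (Or.inl h) (fun hjk => ?_) (fun hjk => ?_))
    · exact blockOf_not_mem_pts_succ hBU (by omega) (not_mem_succ_of_level hk hBU hjk h) (blockIter_succ j x).symm
    · have e' : blockOf ((⟨blockIter j x, μ⟩ : PBond P j).tgt) = blockIter (j + 1) (x.shift μ) := by
        show blockOf ((blockIter j x).shift μ) = _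
        rw [← e, blockIter_succ]
      exact blockOf_not_mem_pts_succ hBU (by omega) (not_mem_succ_of_level hk hBU hjk h') e'

/-- ★★ **ONE LEVEL UP** (`x` of level `j`, `x + e_μ` of level `j + 1 ≤ k`): `ι_j B^j(x) ∈ T ↔ ι_{j+1} B^{j+1}(x + e_μ) ∈ T`.  The `(j+1)`-block `w` of `x` is not that of `x + e_μ`
(`x ∉ Ω_{j+1} ∋ x + e_μ`, a union of `(j+1)`-blocks), so `⟨w, μ⟩` is the level-`(j+1)` OUTWARD CONNECTOR — a print bond: for `j + 1 < k` its source block `B^{j+2}(x)` is off `Ω_{j+2} ⊆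
Ω_{j+1}` ((N)) and its target block, a `Γ_{j+1}`-block, is off `Ω_{j+2}` ((B)); at `j + 1 = k` nothing is excluded — with `ι_{j+1} w = ι_j (centre of w)`, and the centre of `w` is joined
to `B^j(x)` inside `w` (`embIter_mem_iff_of_outerBlock_lam`). [cite: Balaban1984PropagatorsII, (2.3) p.224; Balaban1988Convergent, (2.2) p.255, (2.13) pp.256–257] -/
theorem towerProj_mem_iff_shift_up_lam (hk1 : 1 ≤ k) (hk : k ≤ P.m + P.K) (hnest : ∀ j, 1 ≤ j → j < k → Ω (j + 1) ⊆ Ω j)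
    (hBU : ∀ j, 1 ≤ j → j ≤ k → IsBlockUnion j (Ω j))
    (hsep : ∀ j, 1 ≤ j → j + 1 ≤ k → ∀ (x z : Site P 0) (μ : Fin P.d), (z = x.shift μ ∨ x = z.shift μ) → z ∈ Ω (j + 1) →
      ∀ y : Site P 0, blockIter (j + 1) y = blockIter (j + 1) x → y ∈ Ω j)
    {T : Set (Site P 0)} (hT : ∀ j, j ≤ k → ∀ c ∈ lamBondsSeq Ω k j, (embIter j c.src ∈ T ↔ embIter j c.tgt ∈ T))
    {x : Site P 0} {μ : Fin P.d} {j : ℕ} (hj : j + 1 ≤ k)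
    (h : blockIter j x ∈ genSet Ω k j) (h' : blockIter (j + 1) (x.shift μ) ∈ genSet Ω k (j + 1)) :
    (embIter j (blockIter j x) ∈ T ↔ embIter (j + 1) (blockIter (j + 1) (x.shift μ)) ∈ T) := by
  have hx : x ∉ Ω (j + 1) := not_mem_succ_of_level hk hBU (by omega) h
  have hx' : x.shift μ ∈ Ω (j + 1) := mem_of_level hBU (by omega) hj h'
  rcases blockIter_shift_or (show j + 1 ≤ P.m + P.K by omega) x μ with e | e
  · exfalso
    have hBU1 := hBU (j + 1) (by omega) hj
    have h1 := (hBU1 (x.shift μ)).1 hx'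
    rw [e] at h1
    exact hx ((hBU1 x).2 h1)
  · -- the OUTWARD CONNECTOR `⟨w, μ⟩` at level `j + 1`: its target is the `Γ_{j+1}`-site `B^{j+1}(x + e_μ)`; it is a print bond
    have hc : (⟨blockIter (j + 1) x, μ⟩ : PBond P (j + 1)) ∈ lamBondsSeq Ω k (j + 1) := by
      refine mem_lamBondsSeq_of_not_deep (Or.inr ?_) (fun hjk => ?_) (fun hjk => ?_)
      · show (blockIter (j + 1) x).shift μ ∈ genSet Ω k (j + 1)
        rw [← e]; exact h'
      · -- source block `B^{j+2}(x)`: `x ∉ Ω_{j+1} ⊇ Ω_{j+2}` ((N))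
        have hx2 : x ∉ Ω (j + 1 + 1) := fun hm => hx (hnest (j + 1) (by omega) hjk hm)
        exact blockOf_not_mem_pts_succ hBU (by omega) hx2 (blockIter_succ (j + 1) x).symm
      · -- target block: `x + e_μ` has level `j + 1 < k`, so it is off `Ω_{j+2}` ((B))
        have hx2 : x.shift μ ∉ Ω (j + 1 + 1) := not_mem_succ_of_level hk hBU hjk h'
        have e' : blockOf ((⟨blockIter (j + 1) x, μ⟩ : PBond P (j + 1)).tgt) = blockIter (j + 1 + 1) (x.shift μ) := by
          show blockOf ((blockIter (j + 1) x).shift μ) = _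
          rw [← e]
          exact (blockIter_succ (j + 1) (x.shift μ)).symm
        exact blockOf_not_mem_pts_succ hBU (by omega) hx2 e'
    have step := hT (j + 1) hj _ hc
    -- inside the block `w`: `B^j(x)` and the centre `emb w` are `T`-equivalent
    have hin := embIter_mem_iff_of_outerBlock_lam hk1 hk hBU hsep hj (Or.inl rfl) hx' hx hT (blockIter j x) (emb (blockIter (j + 1) x))
      (blockIter_succ j x).symm (Site.blockOf_emb (by omega) _)
    rw [hin]
    show embIter (j + 1) (blockIter (j + 1) x) ∈ T ↔ _
    rw [step]
    show embIter (j + 1) ((blockIter (j + 1) x).shift μ) ∈ T ↔ _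
    rw [← e]

/-- ★★ **ONE LEVEL DOWN** (`x` of level `j + 1 ≤ k`, `x + e_μ` of level `j`): `ι_{j+1} B^{j+1}(x) ∈ T ↔ ι_j B^j(x + e_μ) ∈ T` — the mirror image of `towerProj_mem_iff_shift_up_lam`
(the outward connector is now `⟨B^{j+1}(x), μ⟩`, sourced in `Γ_{j+1}` — off `Ω_{j+2}` by (B) — with target the outer block `B^{j+1}(x + e_μ)`, off `Ω_{j+2} ⊆ Ω_{j+1}` by (N)).
[cite: Balaban1984PropagatorsII, (2.3) p.224; Balaban1988Convergent, (2.2) p.255, (2.13) pp.256–257] -/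
theorem towerProj_mem_iff_shift_down_lam (hk1 : 1 ≤ k) (hk : k ≤ P.m + P.K) (hnest : ∀ j, 1 ≤ j → j < k → Ω (j + 1) ⊆ Ω j)
    (hBU : ∀ j, 1 ≤ j → j ≤ k → IsBlockUnion j (Ω j))
    (hsep : ∀ j, 1 ≤ j → j + 1 ≤ k → ∀ (x z : Site P 0) (μ : Fin P.d), (z = x.shift μ ∨ x = z.shift μ) → z ∈ Ω (j + 1) →
      ∀ y : Site P 0, blockIter (j + 1) y = blockIter (j + 1) x → y ∈ Ω j)
    {T : Set (Site P 0)} (hT : ∀ j, j ≤ k → ∀ c ∈ lamBondsSeq Ω k j, (embIter j c.src ∈ T ↔ embIter j c.tgt ∈ T))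
    {x : Site P 0} {μ : Fin P.d} {j : ℕ} (hj : j + 1 ≤ k)
    (h : blockIter (j + 1) x ∈ genSet Ω k (j + 1)) (h' : blockIter j (x.shift μ) ∈ genSet Ω k j) :
    (embIter (j + 1) (blockIter (j + 1) x) ∈ T ↔ embIter j (blockIter j (x.shift μ)) ∈ T) := by
  have hx : x ∈ Ω (j + 1) := mem_of_level hBU (by omega) hj h
  have hx' : x.shift μ ∉ Ω (j + 1) := not_mem_succ_of_level hk hBU (by omega) h'
  rcases blockIter_shift_or (show j + 1 ≤ P.m + P.K by omega) x μ with e | e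
  · exfalso
    have hBU1 := hBU (j + 1) (by omega) hj
    have h1 := (hBU1 x).1 hx
    rw [← e] at h1
    exact hx' ((hBU1 (x.shift μ)).2 h1)
  · -- the OUTWARD CONNECTOR `⟨B^{j+1}(x), μ⟩`, sourced in `Γ_{j+1}`; its target is the outer block `w' = B^{j+1}(x + e_μ)`; it is a print bond
    have hc : (⟨blockIter (j + 1) x, μ⟩ : PBond P (j + 1)) ∈ lamBondsSeq Ω k (j + 1) := by
      refine mem_lamBondsSeq_of_not_deep (Or.inl h) (fun hjk => ?_) (fun hjk => ?_)
      · -- source block: `x` has level `j + 1 < k`, so it is off `Ω_{j+2}` ((B))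
        have hx2 : x ∉ Ω (j + 1 + 1) := not_mem_succ_of_level hk hBU hjk h
        exact blockOf_not_mem_pts_succ hBU (by omega) hx2 (blockIter_succ (j + 1) x).symm
      · -- target block `B^{j+2}(x + e_μ)`: `x + e_μ ∉ Ω_{j+1} ⊇ Ω_{j+2}` ((N))
        have hx2 : x.shift μ ∉ Ω (j + 1 + 1) := fun hm => hx' (hnest (j + 1) (by omega) hjk hm)
        have e' : blockOf ((⟨blockIter (j + 1) x, μ⟩ : PBond P (j + 1)).tgt) = blockIter (j + 1 + 1) (x.shift μ) := by
          show blockOf ((blockIter (j + 1) x).shift μ) = _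
          rw [← e]
          exact (blockIter_succ (j + 1) (x.shift μ)).symm
        exact blockOf_not_mem_pts_succ hBU (by omega) hx2 e'
    have step := hT (j + 1) hj _ hc
    have hin := embIter_mem_iff_of_outerBlock_lam hk1 hk hBU hsep hj (Or.inr rfl) hx hx' hT (blockIter j (x.shift μ))
      (emb (blockIter (j + 1) (x.shift μ))) (blockIter_succ j (x.shift μ)).symm (Site.blockOf_emb (by omega) _)
    rw [step, hin]
    show (embIter (j + 1) ((blockIter (j + 1) x).shift μ) ∈ T) ↔ embIter (j + 1) (blockIter (j + 1) (x.shift μ)) ∈ T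
    rw [← e]

/-- ★★ **`T`-INVARIANCE OF THE TOWER PROJECTION ALONG A FINE BOND** for `T` closed under PRINT's bonds `lamBondsSeq Ω k`: a fine site `x` whose `j`-block is a `Γ_j`-site and its neighbour
`x + e_μ` whose `j'`-block is a `Γ_{j'}`-site (`j, j' ≤ k`): `ι_j B^j(x) ∈ T ↔ ι_{j'} B^{j'}(x + e_μ) ∈ T` (the levels are at most one apart, `levels_near_of_shift_genSet`; then
`_same_lam` ∕ `_up_lam` ∕ `_down_lam`). [cite: Balaban1984PropagatorsII, (2.3) p.224; Balaban1988Convergent, (2.2) p.255, (2.13) pp.256–257] -/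
theorem towerProj_mem_iff_shift_lam (hk1 : 1 ≤ k) (hk : k ≤ P.m + P.K) (hnest : ∀ j, 1 ≤ j → j < k → Ω (j + 1) ⊆ Ω j)
    (hBU : ∀ j, 1 ≤ j → j ≤ k → IsBlockUnion j (Ω j))
    (hsep : ∀ j, 1 ≤ j → j + 1 ≤ k → ∀ (x z : Site P 0) (μ : Fin P.d), (z = x.shift μ ∨ x = z.shift μ) → z ∈ Ω (j + 1) →
      ∀ y : Site P 0, blockIter (j + 1) y = blockIter (j + 1) x → y ∈ Ω j)
    {T : Set (Site P 0)} (hT : ∀ j, j ≤ k → ∀ c ∈ lamBondsSeq Ω k j, (embIter j c.src ∈ T ↔ embIter j c.tgt ∈ T))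
    (x : Site P 0) (μ : Fin P.d) {j j' : ℕ} (hj : j ≤ k) (hj' : j' ≤ k)
    (h : blockIter j x ∈ genSet Ω k j) (h' : blockIter j' (x.shift μ) ∈ genSet Ω k j') :
    (embIter j (blockIter j x) ∈ T ↔ embIter j' (blockIter j' (x.shift μ)) ∈ T) := by
  obtain ⟨h1, h2⟩ := levels_near_of_shift_genSet hk hnest hBU hsep hj hj' h h'
  rcases lt_trichotomy j j' with hlt | rfl | hgt
  · obtain rfl : j' = j + 1 := by omega
    exact towerProj_mem_iff_shift_up_lam hk1 hk hnest hBU hsep hT hj' h h'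
  · exact towerProj_mem_iff_shift_same_lam hk hBU hT hj h h'
  · obtain rfl : j = j' + 1 := by omega
    exact towerProj_mem_iff_shift_down_lam hk1 hk hnest hBU hsep hT hj h h'

/-- **THE LEVEL PREDICATE «`ι_j B^j(x) ∈ T` at the level `j` of `x`» IS INVARIANT UNDER `x ↦ x + e_μ`** for `T` closed under print's bonds (levels exist and are unique, lane §1).
[cite: Balaban1984PropagatorsII, (2.3) p.224; Balaban1988Convergent, (2.2) p.255, (2.13) pp.256–257] -/
theorem levelPred_iff_shift_lam (hk1 : 1 ≤ k) (hk : k ≤ P.m + P.K) (hnest : ∀ j, 1 ≤ j → j < k → Ω (j + 1) ⊆ Ω j)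
    (hBU : ∀ j, 1 ≤ j → j ≤ k → IsBlockUnion j (Ω j))
    (hsep : ∀ j, 1 ≤ j → j + 1 ≤ k → ∀ (x z : Site P 0) (μ : Fin P.d), (z = x.shift μ ∨ x = z.shift μ) → z ∈ Ω (j + 1) →
      ∀ y : Site P 0, blockIter (j + 1) y = blockIter (j + 1) x → y ∈ Ω j)
    {T : Set (Site P 0)} (hT : ∀ j, j ≤ k → ∀ c ∈ lamBondsSeq Ω k j, (embIter j c.src ∈ T ↔ embIter j c.tgt ∈ T))
    (x : Site P 0) (μ : Fin P.d) :
    (∀ j, j ≤ k → blockIter j x ∈ genSet Ω k j → embIter j (blockIter j x) ∈ T) ↔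
      (∀ j, j ≤ k → blockIter j (x.shift μ) ∈ genSet Ω k j → embIter j (blockIter j (x.shift μ)) ∈ T) := by
  obtain ⟨j₀, hj₀, h₀⟩ := exists_level_genSet hk1 hk hBU x
  obtain ⟨j₁, hj₁, h₁⟩ := exists_level_genSet hk1 hk hBU (x.shift μ)
  have key := towerProj_mem_iff_shift_lam hk1 hk hnest hBU hsep hT x μ hj₀ hj₁ h₀ h₁
  constructor
  · intro H j hj h
    obtain rfl : j = j₁ := level_unique_genSet hk hnest hBU hj hj₁ h h₁
    exact key.1 (H j₀ hj₀ h₀)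
  · intro H j hj h
    obtain rfl : j = j₀ := level_unique_genSet hk hnest hBU hj hj₀ h h₀
    exact key.2 (H j₁ hj₁ h₁)

/-- … hence invariant along every lattice walk (induction on the word; a backward letter is a forward one read from the other end). [cite: Balaban1987RG1, (0.1) p.251 (the torus; bookkeeping)] -/
theorem levelPred_walkEnd_lam (hk1 : 1 ≤ k) (hk : k ≤ P.m + P.K) (hnest : ∀ j, 1 ≤ j → j < k → Ω (j + 1) ⊆ Ω j)
    (hBU : ∀ j, 1 ≤ j → j ≤ k → IsBlockUnion j (Ω j))
    (hsep : ∀ j, 1 ≤ j → j + 1 ≤ k → ∀ (x z : Site P 0) (μ : Fin P.d), (z = x.shift μ ∨ x = z.shift μ) → z ∈ Ω (j + 1) →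
      ∀ y : Site P 0, blockIter (j + 1) y = blockIter (j + 1) x → y ∈ Ω j)
    {T : Set (Site P 0)} (hT : ∀ j, j ≤ k → ∀ c ∈ lamBondsSeq Ω k j, (embIter j c.src ∈ T ↔ embIter j c.tgt ∈ T)) :
    ∀ (w : List (Fin P.d × Bool)) (r : Site P 0),
      (∀ j, j ≤ k → blockIter j r ∈ genSet Ω k j → embIter j (blockIter j r) ∈ T) ↔
        (∀ j, j ≤ k → blockIter j (walkEnd r w) ∈ genSet Ω k j → embIter j (blockIter j (walkEnd r w)) ∈ T)
  | [], _ => Iff.rfl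
  | (μ, true) :: w, r => (levelPred_iff_shift_lam hk1 hk hnest hBU hsep hT r μ).trans (levelPred_walkEnd_lam hk1 hk hnest hBU hsep hT w (r.shift μ))
  | (μ, false) :: w, r => by
    have h := levelPred_iff_shift_lam hk1 hk hnest hBU hsep hT (r.unshift μ) μ
    rw [B10StarCount.shift_unshift] at h
    exact h.symm.trans (levelPred_walkEnd_lam hk1 hk hnest hBU hsep hT w (r.unshift μ))

/-- … hence CONSTANT on the (connected) fine torus (dag-n12-w3's `exists_word_walkEnd_eq`). [cite: Balaban1987RG1, (0.1) p.251 (the torus; bookkeeping)] -/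
theorem levelPred_const_lam (hk1 : 1 ≤ k) (hk : k ≤ P.m + P.K) (hnest : ∀ j, 1 ≤ j → j < k → Ω (j + 1) ⊆ Ω j)
    (hBU : ∀ j, 1 ≤ j → j ≤ k → IsBlockUnion j (Ω j))
    (hsep : ∀ j, 1 ≤ j → j + 1 ≤ k → ∀ (x z : Site P 0) (μ : Fin P.d), (z = x.shift μ ∨ x = z.shift μ) → z ∈ Ω (j + 1) →
      ∀ y : Site P 0, blockIter (j + 1) y = blockIter (j + 1) x → y ∈ Ω j)
    {T : Set (Site P 0)} (hT : ∀ j, j ≤ k → ∀ c ∈ lamBondsSeq Ω k j, (embIter j c.src ∈ T ↔ embIter j c.tgt ∈ T))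
    (x y : Site P 0) :
    (∀ j, j ≤ k → blockIter j x ∈ genSet Ω k j → embIter j (blockIter j x) ∈ T) ↔
      (∀ j, j ≤ k → blockIter j y ∈ genSet Ω k j → embIter j (blockIter j y) ∈ T) := by
  obtain ⟨w, hw⟩ := exists_word_walkEnd_eq x y
  subst hw
  exact levelPred_walkEnd_lam hk1 hk hnest hBU hsep hT w x

/-! ## §3  Connectivity of the tower-site graph of print's datum `lamBondsSeq Ω k` -/

/-- At the representative `ι_j s` of a `Γ_j`-SITE `s` (`j ≤ k`) the level predicate of §2 reads `ι_j s ∈ T` (levels are unique). [cite: Balaban1988Convergent, (2.2) p.255] -/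
theorem levelPred_embIter_iff (hk : k ≤ P.m + P.K) (hnest : ∀ j, 1 ≤ j → j < k → Ω (j + 1) ⊆ Ω j)
    (hBU : ∀ j, 1 ≤ j → j ≤ k → IsBlockUnion j (Ω j)) (T : Set (Site P 0)) {j : ℕ} (hj : j ≤ k) {s : Site P j} (hs : s ∈ genSet Ω k j) :
    (∀ i, i ≤ k → blockIter i (embIter j s) ∈ genSet Ω k i → embIter i (blockIter i (embIter j s)) ∈ T) ↔ embIter j s ∈ T := by
  have hb : blockIter j (embIter j s) = s := blockIter_embIter (hj.trans hk) s
  have hsj : blockIter j (embIter j s) ∈ genSet Ω k j := by rw [hb]; exact hs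
  constructor
  · intro H
    have h := H j hj hsj
    rwa [hb] at h
  · intro hsT i hi hi'
    obtain rfl : i = j := level_unique_genSet hk hnest hBU hi hj hi' hsj
    rw [hb]; exact hsT

/-- ★★★ **FROM ONE `Γ`-SITE TO EVERY PRINT TOWER SITE, BOTH ENDS** (every nested block-union sequence `Ω` with one-block collars, (N)(B)(S); `1 ≤ k ≤ m + K`): a set `T` of fine sites CLOSED
under PRINT's bonds (`ι_j c₋ ∈ T ↔ ι_j c₊ ∈ T` for every `c ∈ lamBondsSeq Ω k j`, `j ≤ k` — a WEAKER closedness than the (b)-datum's) that holds the representative `ι_{j₁} s₁` of ONE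
`Γ_{j₁}`-site `s₁` (`j₁ ≤ k`) holds `ι_j c₋` AND `ι_j c₊` for every print bond `c ∈ lamBondsSeq Ω k j`, `j ≤ k` — §2's constancy read at `ι_{j₁} s₁` and at the `Γ`-end of `c`, the
other end being `T`-equivalent by closedness. [cite: Balaban1984PropagatorsII, (2.3) p.224; Balaban1988Convergent, (2.2) p.255, (2.13) pp.256–257; Balaban1985Variational, Thm 1 p.279, (3)–(4) p.278] -/
theorem towerSite_mem_of_closed_lamBondsSeq_of_mem_genSet (hk1 : 1 ≤ k) (hk : k ≤ P.m + P.K) (hnest : ∀ j, 1 ≤ j → j < k → Ω (j + 1) ⊆ Ω j)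
    (hBU : ∀ j, 1 ≤ j → j ≤ k → IsBlockUnion j (Ω j))
    (hsep : ∀ j, 1 ≤ j → j + 1 ≤ k → ∀ (x z : Site P 0) (μ : Fin P.d), (z = x.shift μ ∨ x = z.shift μ) → z ∈ Ω (j + 1) →
      ∀ y : Site P 0, blockIter (j + 1) y = blockIter (j + 1) x → y ∈ Ω j)
    (T : Set (Site P 0)) (hT : ∀ j, j ≤ k → ∀ c ∈ lamBondsSeq Ω k j, (embIter j c.src ∈ T ↔ embIter j c.tgt ∈ T))
    {j₁ : ℕ} (hj₁ : j₁ ≤ k) {s₁ : Site P j₁} (hs₁ : s₁ ∈ genSet Ω k j₁) (hz₁ : embIter j₁ s₁ ∈ T)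
    {j₂ : ℕ} (hj₂ : j₂ ≤ k) {c₂ : PBond P j₂} (hc₂ : c₂ ∈ lamBondsSeq Ω k j₂) : embIter j₂ c₂.src ∈ T ∧ embIter j₂ c₂.tgt ∈ T := by
  have P1 := (levelPred_embIter_iff hk hnest hBU T hj₁ hs₁).2 hz₁
  have hsrc : embIter j₂ c₂.src ∈ T := by
    rcases src_or_tgt_mem_genSet_of_mem_lamBondsSeq hc₂ with h | h
    · exact (levelPred_embIter_iff hk hnest hBU T hj₂ h).1 ((levelPred_const_lam hk1 hk hnest hBU hsep hT (embIter j₁ s₁) (embIter j₂ c₂.src)).1 P1)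
    · exact (hT j₂ hj₂ c₂ hc₂).2 ((levelPred_embIter_iff hk hnest hBU T hj₂ h).1
        ((levelPred_const_lam hk1 hk hnest hBU hsep hT (embIter j₁ s₁) (embIter j₂ c₂.tgt)).1 P1))
  exact ⟨hsrc, (hT j₂ hj₂ c₂ hc₂).1 hsrc⟩

/-- ★★★ **THE TOWER-SITE CONSTRAINT GRAPH OF PRINT's DATUM `lamBondsSeq Ω k` IS CONNECTED** ((N)(B)(S); `1 ≤ k ≤ m + K`): a set `T` of fine sites CLOSED under print's bonds that contains
ONE tower site `ι_{j₁} c₁₋` of a print bond `c₁` contains EVERY tower site `ι_{j₂} c₂₋` of every print bond `c₂` — by shape the negation of the disconnection data `(hT, hz₁, hz₂)` of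
dag-n12-w1's `N12Thm1CentralLetterTwistObstruction.not_T1central_flat_of_disconnected` read at the bond-level datum `lamBondsSeq Ω k`: the twist obstruction against the uniqueness
clause NEVER fires at [II] (2.3)'s `Λ_j`.  (`c₁` has an end in `Γ_{j₁}`, in `T` directly or by closedness; then the site-fed form.)
[cite: Balaban1984PropagatorsII, (2.3) p.224; Balaban1988Convergent, (2.2) p.255, (2.13) pp.256–257; Balaban1985Variational, Thm 1 p.279, (3)–(4) p.278] -/
theorem towerSite_mem_of_closed_lamBondsSeq (hk1 : 1 ≤ k) (hk : k ≤ P.m + P.K) (hnest : ∀ j, 1 ≤ j → j < k → Ω (j + 1) ⊆ Ω j)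
    (hBU : ∀ j, 1 ≤ j → j ≤ k → IsBlockUnion j (Ω j))
    (hsep : ∀ j, 1 ≤ j → j + 1 ≤ k → ∀ (x z : Site P 0) (μ : Fin P.d), (z = x.shift μ ∨ x = z.shift μ) → z ∈ Ω (j + 1) →
      ∀ y : Site P 0, blockIter (j + 1) y = blockIter (j + 1) x → y ∈ Ω j)
    (T : Set (Site P 0)) (hT : ∀ j, j ≤ k → ∀ c ∈ lamBondsSeq Ω k j, (embIter j c.src ∈ T ↔ embIter j c.tgt ∈ T))
    {j₁ : ℕ} (hj₁ : j₁ ≤ k) {c₁ : PBond P j₁} (hc₁ : c₁ ∈ lamBondsSeq Ω k j₁) (hz₁ : embIter j₁ c₁.src ∈ T)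
    {j₂ : ℕ} (hj₂ : j₂ ≤ k) {c₂ : PBond P j₂} (hc₂ : c₂ ∈ lamBondsSeq Ω k j₂) : embIter j₂ c₂.src ∈ T := by
  -- `c₁` has an end in `Γ_{j₁}` whose representative lies in `T`
  rcases src_or_tgt_mem_genSet_of_mem_lamBondsSeq hc₁ with h | h
  · exact (towerSite_mem_of_closed_lamBondsSeq_of_mem_genSet hk1 hk hnest hBU hsep T hT hj₁ h hz₁ hj₂ hc₂).1
  · exact (towerSite_mem_of_closed_lamBondsSeq_of_mem_genSet hk1 hk hnest hBU hsep T hT hj₁ h ((hT j₁ hj₁ c₁ hc₁).1 hz₁) hj₂ hc₂).1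

/-- ★★★ **ALL PRINT TOWER SITES, BOTH ENDS**: under the hypotheses of `towerSite_mem_of_closed_lamBondsSeq`, `T` contains `ι_j c₋` and `ι_j c₊` for every print bond `c ∈ lamBondsSeq Ω k j`
of every level `j ≤ k`. [cite: Balaban1984PropagatorsII, (2.3) p.224; Balaban1988Convergent, (2.2) p.255, (2.13) pp.256–257; Balaban1985Variational, Thm 1 p.279] -/
theorem towerSites_subset_of_closed_lamBondsSeq (hk1 : 1 ≤ k) (hk : k ≤ P.m + P.K) (hnest : ∀ j, 1 ≤ j → j < k → Ω (j + 1) ⊆ Ω j)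
    (hBU : ∀ j, 1 ≤ j → j ≤ k → IsBlockUnion j (Ω j))
    (hsep : ∀ j, 1 ≤ j → j + 1 ≤ k → ∀ (x z : Site P 0) (μ : Fin P.d), (z = x.shift μ ∨ x = z.shift μ) → z ∈ Ω (j + 1) →
      ∀ y : Site P 0, blockIter (j + 1) y = blockIter (j + 1) x → y ∈ Ω j)
    (T : Set (Site P 0)) (hT : ∀ j, j ≤ k → ∀ c ∈ lamBondsSeq Ω k j, (embIter j c.src ∈ T ↔ embIter j c.tgt ∈ T))
    {j₁ : ℕ} (hj₁ : j₁ ≤ k) {c₁ : PBond P j₁} (hc₁ : c₁ ∈ lamBondsSeq Ω k j₁) (hz₁ : embIter j₁ c₁.src ∈ T) :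
    ∀ j, j ≤ k → ∀ c ∈ lamBondsSeq Ω k j, embIter j c.src ∈ T ∧ embIter j c.tgt ∈ T := fun j hj c hc =>
  have h := towerSite_mem_of_closed_lamBondsSeq hk1 hk hnest hBU hsep T hT hj₁ hc₁ hz₁ hj hc
  ⟨h, (hT j hj c hc).1 h⟩

/-- ★★ **THE TWIST OBSTRUCTION's PREMISE SET IS EMPTY AT PRINT's DATUM FOR EVERY NESTED BLOCK-UNION SEQUENCE WITH ONE-BLOCK COLLARS**: there is NO set of fine sites closed under print's
bonds `lamBondsSeq Ω k` separating two of their tower sites — the disconnection data `(T, hT, j₁, c₁, hz₁, j₂, c₂, hz₂)` of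
`N12Thm1CentralLetterTwistObstruction.not_T1central_flat_of_disconnected`, read at the bond-level datum `lamBondsSeq Ω k`, cannot be supplied (`1 ≤ k ≤ m + K`, (N)(B)(S)).
[cite: Balaban1984PropagatorsII, (2.3) p.224; Balaban1988Convergent, (2.2) p.255, (2.1) p.254, p.256; Balaban1985Variational, Thm 1 p.279, (3)–(4) p.278] -/
theorem not_disconnected_towerSiteGraph_lamBondsSeq (hk1 : 1 ≤ k) (hk : k ≤ P.m + P.K) (hnest : ∀ j, 1 ≤ j → j < k → Ω (j + 1) ⊆ Ω j)
    (hBU : ∀ j, 1 ≤ j → j ≤ k → IsBlockUnion j (Ω j))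
    (hsep : ∀ j, 1 ≤ j → j + 1 ≤ k → ∀ (x z : Site P 0) (μ : Fin P.d), (z = x.shift μ ∨ x = z.shift μ) → z ∈ Ω (j + 1) →
      ∀ y : Site P 0, blockIter (j + 1) y = blockIter (j + 1) x → y ∈ Ω j) :
    ¬ ∃ (T : Set (Site P 0)) (j₁ : ℕ) (c₁ : PBond P j₁) (j₂ : ℕ) (c₂ : PBond P j₂),
        (∀ j, j ≤ k → ∀ c ∈ lamBondsSeq Ω k j, (embIter j c.src ∈ T ↔ embIter j c.tgt ∈ T)) ∧
        j₁ ≤ k ∧ c₁ ∈ lamBondsSeq Ω k j₁ ∧ embIter j₁ c₁.src ∈ T ∧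
        j₂ ≤ k ∧ c₂ ∈ lamBondsSeq Ω k j₂ ∧ embIter j₂ c₂.src ∉ T := by
  rintro ⟨T, j₁, c₁, j₂, c₂, hT, hj₁, hc₁, hz₁, hj₂, hc₂, hz₂⟩
  exact hz₂ (towerSite_mem_of_closed_lamBondsSeq hk1 hk hnest hBU hsep T hT hj₁ hc₁ hz₁ hj₂ hc₂)

end Summit.QuantumFields.YangMills.BalabanUVNodes.N12TowerSiteGraphConnectedNestedLam
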